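import Mathlib
import Summits.ValiantsHypothesis.ValiantsHypothesis.Theses.ValuativeGCT
import Summits.ValiantsHypothesis.ValiantsHypothesis.Theorems.ValuativeGCTValuativeFlipIsotypicBinomialTail
import Summits.ValiantsHypothesis.ValiantsHypothesis.Theorems.ValuativeGCTValuativeFlipPerAnchorInheritanceEvery

/-!
# The crux from INNER multiplicities: `ValuativeFlip ⇐ InnerRichness` (per-side residual in explicit currency)

Wall-breaker axis P-explicit (explicit padded-permanent highest-weight vectors) for crux
`ValuativeGCT.ValuativeFlip` (stmt-ValiantsHypothesis-12624).  After twist positivity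
(`perAnchorInheritance_every`, BLMW 2011 Problem 6.10 "≥" at EVERY padding) and the binomial isotypic
det census (`isotypic_truncT_rowLift_finrank_le_choose`, independent of the first row and of the
degree), the per side of the tail needs no padding, no twist and no `Γ`-variety: it is a statement
about the multiplicities `P_n(μ) = mult_{μ*} ℂ[Δ_n(per_n)]` of the coordinate ring of the orbit closure
of `per_n` ITSELF.

* `flipBody_of_innerMultiplicity` — for `m = n + j ≥ 2` and an inner shape `μ ⊢ nδ` (at most `n²`
  parts) with `P_n(μ) > C(μ₂ + m, m) · ∏_{i ≥ 3} C(μ_i + m² - 1, m² - 1)`, the body of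
  `ValuativeGCT.ValuativeFlip` holds at `(n, m)` (verbatim `let χ; let T`; witnesses `U = ⊥`, `r = 0`,
  degree `δ`, shape `μ♯m`);
* `detOrbitMultiplicity_rowLift_lt_of_innerMultiplicity` — under the same hypothesis the
  Mulmuley–Sohoni obstruction `K_m((μ♯)*) < mult_{(μ♯)*} ℂ[Δ_m(X₀₀^j per_n)]`;
* `valuativeFlip_of_innerRichness` — **the crux BY NAME from `InnerRichness`**: if eventually in
  `n`, at every window position `n ≤ m ≤ 2^((log₂ n + c)^c)`, some inner shape `μ` has
  `P_n(μ)` above that binomial threshold, then `ValuativeGCT.ValuativeFlip`.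

So an explicit-HWV programme for the crux has exactly one target left: exhibit, at inner size `n`,
highest-weight vectors of weight `μ*` on `ℂ[Sym^n ℂ^{n×n}]` whose evaluation matrix at points
`A · per_n` (certificate currency, `stub_evalRankLowerBound`) has rank above
`C(μ₂ + m, m) · ∏_{i ≥ 3} C(μ_i + m² - 1, m² - 1)`; the shape must have growing length and a large
body (`|μ̄| > m`: `…NoSmallBodyEquations`; bounded length dies, `valuativeFlip_iff_longShapes`), and
such a certificate forces `X₀₀^{m-n} per_n ∉ Δ(det_m)` (certificate domination), i.e. it is of the
strength of the summit in the tail.  Pure composition of landed theorems. [this crux; new]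
-/

set_option linter.dupNamespace false
set_option maxHeartbeats 800000

namespace Summit.ValiantsHypothesis.ValiantsHypothesis.Theorems.ValuativeFlip

open MvPolynomial
open scoped BigOperators Matrix
open Literature.NumberTheory.DiophantineGeometry
open Literature.Computability.AlgebraicComplexity
open Literature.Computability.Complexity

noncomputable section

/-- **The flip body from an inner multiplicity** (tail criterion of the crux in the currency of
the orbit closure of `per_n` itself).  Let `m = n + j ≥ 2` and `μ ⊢ nδ` with at most `n²` parts, and
suppose `P_n(μ) = mult_{μ*} ℂ[Δ_n(per_n)] > C(μ₂ + m, m) · ∏_{i ≥ 3} C(μ_i + m² - 1, m² - 1)`.  Then the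
body of `ValuativeGCT.ValuativeFlip` holds at `(n, m)` (verbatim `let χ; let T`), with `U = ⊥`,
`r = 0`, degree `δ` and the lifted shape `λ = μ♯m`:
`dim T_⊥(μ♯) ≤ binomial census < P_n(μ) ≤ mult_{(μ♯)*} ℂ[Δ_m(X₀₀^j per_n)]`
(`perAnchorInheritance_every`). [this crux; new] -/
theorem flipBody_of_innerMultiplicity (n j δ : ℕ) [NeZero n] [NeZero (n + j)] (hm : 2 ≤ n + j)
    (μ : Nat.Partition (n * δ)) (hμ : μ.parts.card ≤ n * n)
    (hP : (μ.sortedParts.getD 1 0 + (n + j)).choose (n + j) *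
        ∏ i ∈ Finset.Ico 2 ((n + j) * (n + j)),
          (μ.sortedParts.getD i 0 + ((n + j) * (n + j) - 1)).choose ((n + j) * (n + j) - 1) <
      orbitMultiplicity ℂ (paddedPerFormLex ℂ n n) n (partitionWeightLex n μ)) :
    ∃ (U : Submodule ℂ (MatIdx (n + j) → ℂ)) (r δ' : ℕ) (lam : Nat.Partition ((n + j) * δ')),
            (∀ u ∈ U, (Matrix.of fun a b : Fin (n + j) => u (toLex (a, b))).rank ≤ r) ∧
            lam.parts.card ≤ (n + j) * (n + j) ∧
            (let χ : Weight (MatIdx (n + j)) := (Weight.dualOfPartition ((n + j) * (n + j)) lam).toMatIdx;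
             let T : Submodule ℂ (MvPolynomial (MatIdx (n + j) × MatIdx (n + j)) ℂ) :=
               MvPolynomial.homogeneousSubmodule (MatIdx (n + j) × MatIdx (n + j)) ℂ ((n + j) * δ') ⊓
                 ((MvPolynomial.vanishingIdeal ℂ {p : MatIdx (n + j) × MatIdx (n + j) → ℂ |
                     ∀ j' : MatIdx (n + j), (fun i => p (j', i)) ∈ U}) ^ (δ' * (n + j - r))).restrictScalars ℂ ⊓
                 (⨅ (M : Matrix (MatIdx (n + j)) (MatIdx (n + j)) ℂ)
                   (_ : linSubst (MatIdx (n + j)) ℂ M (detFormLex ℂ (n + j)) = detFormLex ℂ (n + j)),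
                   LinearMap.ker ((MvPolynomial.aeval (R := ℂ) fun p : MatIdx (n + j) × MatIdx (n + j) =>
                       ∑ l : MatIdx (n + j), M l p.2 • MvPolynomial.X (p.1, l)).toLinearMap -
                     LinearMap.id (R := ℂ) (M := MvPolynomial (MatIdx (n + j) × MatIdx (n + j)) ℂ))) ⊓
                 (⨅ (g : Matrix.GeneralLinearGroup (MatIdx (n + j)) ℂ) (_ : IsUpperTriangular g),
                   LinearMap.ker ((MvPolynomial.aeval (R := ℂ) fun p : MatIdx (n + j) × MatIdx (n + j) =>
                       ∑ l : MatIdx (n + j), ((g⁻¹ : Matrix.GeneralLinearGroup (MatIdx (n + j)) ℂ) :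
                         Matrix (MatIdx (n + j)) (MatIdx (n + j)) ℂ) p.1 l • MvPolynomial.X (l, p.2)).toLinearMap -
                     weightChar χ g • LinearMap.id (R := ℂ) (M := MvPolynomial (MatIdx (n + j) × MatIdx (n + j)) ℂ)));
             Module.finrank ℂ ↥T < orbitMultiplicity ℂ (paddedPerFormLex ℂ n (n + j)) (n + j) χ) := by
  have hinh := perAnchorInheritance_every n j δ μ hμ
  refine ⟨⊥, 0, δ, rowLift μ j, ?_, iso_card_parts_rowLift_le_sq n j δ (by omega) μ hμ, ?_⟩
  · intro u hu
    rw [Submodule.mem_bot] at hu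
    subst hu
    have h0 : (Matrix.of fun a b : Fin (n + j) => (0 : MatIdx (n + j) → ℂ) (toLex (a, b))) = 0 := by
      ext a b
      simp
    rw [h0, Matrix.rank_zero]
  · intro χ T
    exact lt_of_le_of_lt (isotypic_truncT_rowLift_finrank_le_choose n j hm ⊥ 0 δ μ)
      (lt_of_lt_of_le hP hinh)

/-- **Mulmuley–Sohoni obstruction from an inner multiplicity.**  Under the same hypothesis,
`K_m((μ♯)*) < mult_{(μ♯)*} ℂ[Δ_m(X₀₀^j per_n)]` at `m = n + j`. [this crux; Mulmuley–Sohoni 2001 §4] -/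
theorem detOrbitMultiplicity_rowLift_lt_of_innerMultiplicity (n j δ : ℕ) [NeZero n] [NeZero (n + j)]
    (hm : 2 ≤ n + j) (μ : Nat.Partition (n * δ)) (hμ : μ.parts.card ≤ n * n)
    (hP : (μ.sortedParts.getD 1 0 + (n + j)).choose (n + j) *
        ∏ i ∈ Finset.Ico 2 ((n + j) * (n + j)),
          (μ.sortedParts.getD i 0 + ((n + j) * (n + j) - 1)).choose ((n + j) * (n + j) - 1) <
      orbitMultiplicity ℂ (paddedPerFormLex ℂ n n) n (partitionWeightLex n μ)) :
    orbitMultiplicity ℂ (detFormLex ℂ (n + j)) (n + j) (partitionWeightLex (n + j) (rowLift μ j)) <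
      orbitMultiplicity ℂ (paddedPerFormLex ℂ n (n + j)) (n + j)
        (partitionWeightLex (n + j) (rowLift μ j)) :=
  lt_of_le_of_lt (isotypic_detOrbitMultiplicity_rowLift_le_choose n j hm δ μ hμ)
    (lt_of_lt_of_le hP (perAnchorInheritance_every n j δ μ hμ))

/-- **The crux from inner richness.**  `InnerRichness`: for every `c`, eventually in `n`, at every
window position `n ≤ m ≤ 2^((log₂ n + c)^c)` some inner shape `μ ⊢ nδ` (at most `n²` parts) has
`P_n(μ) = mult_{μ*} ℂ[Δ_n(per_n)] > C(μ₂ + m, m) · ∏_{i ≥ 3} C(μ_i + m² - 1, m² - 1)`.  Then the route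
decl `ValuativeGCT.ValuativeFlip` (stmt-ValiantsHypothesis-12624) holds, BY NAME.  This is the whole
crux reduced to the multiplicities of ONE fixed graded `GL_{n²}`-algebra per `n`, the coordinate ring of
the orbit closure of the permanent. [this crux; new] -/
theorem valuativeFlip_of_innerRichness
    (H : ∀ c : ℕ, ∃ n₀ : ℕ, ∀ (n : ℕ) [NeZero n], n₀ ≤ n → ∀ m : ℕ, n ≤ m →
      m ≤ 2 ^ ((Nat.log 2 n + c) ^ c) →
      ∃ (δ : ℕ) (μ : Nat.Partition (n * δ)), μ.parts.card ≤ n * n ∧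
        (μ.sortedParts.getD 1 0 + m).choose m *
            ∏ i ∈ Finset.Ico 2 (m * m), (μ.sortedParts.getD i 0 + (m * m - 1)).choose (m * m - 1) <
          orbitMultiplicity ℂ (paddedPerFormLex ℂ n n) n (partitionWeightLex n μ)) :
    Summit.ValiantsHypothesis.ValiantsHypothesis.Theses.ValuativeGCT.ValuativeFlip := by
  intro c
  obtain ⟨n₀, h⟩ := H c
  refine ⟨max n₀ 2, fun n hn m _ hnm hm => ?_⟩
  haveI : NeZero n := ⟨by have := le_of_max_le_right hn; omega⟩
  obtain ⟨δ, μ, hμ, hlt⟩ := h n (le_of_max_le_left hn) m hnm hm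
  obtain ⟨j, rfl⟩ : ∃ j, m = n + j := ⟨m - n, by omega⟩
  exact flipBody_of_innerMultiplicity n j δ (by have := le_of_max_le_right hn; omega) μ hμ hlt

end

end Summit.ValiantsHypothesis.ValiantsHypothesis.Theorems.ValuativeFlip
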